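import Summits.BirchSwinnertonDyer.Rank1Residual.O5.HeegnerLogTransportThreeResidual
import Summits.BirchSwinnertonDyer.Rank1Residual.O5.HeegnerLogTransportThreeOrdTwist
import Summits.BirchSwinnertonDyer.Rank1Residual.O5.HeegnerLogTransportThreeBaseSelmer
import Summits.BirchSwinnertonDyer.Rank1Residual.O5.HeegnerLogTransportThreeGoodSelmer
import HarnessLib
import HarnessLib.Audit.Tags

/-!
# Heegner-log transport at `p = 3` (KL3), part 9 (END): the three KL3-C♭ assemblies WITHOUT the base-Selmer
# binders KL3-B and KL3-G (and without KL3-M) — o5-r2 GEN 21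

HONEST FRAMING (cell `b2b-bsdres`, run/shared/lean/b2b/bsd-rank1-residual/, verbatim in every file): the
goal of the cell is to DELETE the COMBINATION-SHAPED residual classes of the Birch–Swinnerton-Dyer formula
for ALL analytic-rank `≤ 1` elliptic curves over `ℚ` — "full BSD formula for every rank `≤ 1` curve in
class `C`" assembled STRICTLY from published theorems — so that the rank-`≤ 1` remainder becomes exactly
the CONSTRUCTION-SHAPED classes, which are TYPED (missing-input `Prop`s), NOT attempted. This is not
"finishing BSD". Team O5 (tame potentially supersingular additive `p = 3`, (t′)), planner o5-r2 (the
non-Iwasawa side), GEN 21; RESEARCH ROUTE; THEOREMS ONLY (bookkeeping over explicit hypotheses): no new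
node is WANTED, no Literature fact, no `@[conjecture]`, no new object; NOTHING is booked and no mark of
`RESIDUAL-MAP.md` moves. O5 OPEN.

## What this file records (GEN 20 docket (b); memo `HOME/b2b-bsdres-o5-r2/gen21/O5-GEN21.md`)

Parts 8 and 10 of the same generation PROVE, modulo two TEXTBOOK facts displayed as hypotheses, everything the
END theorems consumed from the two print-shaped base-Selmer nodes:

* part 8 (`O5/HeegnerLogTransportThreeBaseSelmer.lean`): the only consumed direction of KL3-B
  `O5BaseSelmerCountThree` — `Sel_𝔭(K, W[3^∞]) = 0` from `#Ш(W/K)[3^∞] = 1` and a unit-log point — at the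
  ADDITIVE prime `3` (Kolyvagin's conclusions, the additive local index `#W̃_ns(𝔽₃) = 3`, `3 ∤ c₃`, and the
  `≤` half of JSW17 Prop. 3.2.1: `selmerAcBase_card_eq_one_of_facts`);
* part 10 (`O5/HeegnerLogTransportThreeGoodSelmer.lean`): KL3-G `GoodBaseSelmerCountThree` ITSELF (the exact
  count at the good companion, both halves of Poitou–Tate: `goodBaseSelmerCountThree_of_facts`), from the
  general exact count under (iv) `natCard_selmerAcBase_eq_pow_of_noLocalTorsion` (X11b's gen-19 exact count
  with the reduction-type-free local exponent).

The two textbook facts are the tree's named facts `poitouTate_selmerStructure_duality K` (Poitou–Tate duality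
for Selmer structures: Milne ADT I Cor. 2.3 / Thm. 4.10, Howard Thm. 2.1.11; it implies the weaker
`poitouTate_sum_localTatePairing_eq_zero K` used by part 8, tree lemma
`poitouTate_sum_localTatePairing_eq_zero_of_selmerStructure_duality`) and `localEulerPoincareCharacteristic`
(Milne ADT I 2.8), displayed as the hypotheses `hPT`, `hEP` (universally quantified over the number field)
exactly as the cell's X11b files consume them (`X11b/BDPRouteSelmerCountExact.lean`). So the binders
`hB : O5BaseSelmerCountThree` AND `hG : GoodBaseSelmerCountThree` of o5-r2 GEN 20's three END theorems

* `o5_index_unit_of_good_companion_selmer_residual`, `o5_index_unit_of_goodOrd_companion_selmer_residual`,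
  `o5_index_unit_of_ordinary_companion_residual` (part 7 END, `O5/HeegnerLogTransportThreeResidualEnd.lean`)

are DELETED here: the three theorems below are those three VERBATIM (statements and proofs) except that
(i) the binders `hB`, `hG` are replaced by the two textbook-fact binders `hPT`, `hEP`; (ii) the use
`selmerAcBase_card_eq_one_of_units hB …` is now part 8's THEOREM `selmerAcBase_card_eq_one_of_facts …` (fed by
the END's own `htam`, `hKoW`, Heegner datum, `hshaW`, `hQW`) and the use
`sha_trivial_and_klLog_eq_of_selmer_trivial hG …` is now part 10's THEOREM
`sha_trivial_and_klLog_eq_of_selmer_trivial_of_facts hPT hEP …`; (iii) the class binders `hj : 0 ≤ v₃(j_W)` and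
`hf₂ : Additive.CondExpTwo W 3`, which were consumed ONLY by KL3-B, are dropped (the END now holds for every `W`
additive at `3` with the displayed hypotheses; on the O5 (t′) population they are data of the class). The
GEN 18/19/20 originals and the nodes KL3-B / KL3-G stay in the tree unchanged (correct and citable; KL3-G is now
a theorem modulo `hPT`/`hEP`, KL3-B's consumed direction likewise).

NET for the KL3 chain after GEN 21 (memo §3): END `o5_index_unit_of_ordinary_companion_facts` — KL3-C♭ at
`embAt 𝔭` (hence, by KL3-A, `3 ∤ [W(K) : ℤP]`) on the C-KL3-V pairs with a good-ordinary companion is a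
theorem modulo the ONE remaining TYPED node KL3-A (`KrizLiUnitBitTransportThree`, print: Kriz–Li Thm. 1.16 /
Rem. 1.17), the two textbook facts `hPT`/`hEP`, the named facts (modularity `hmod`, Gross–Zagier `hGZG`,
Gross–Zagier–Kolyvagin `hGZK`, Kolyvagin `hKoW`/`hKoG`, Yan–Zhu 2026 Thm. 4.15 `hYZ`, Wuthrich Lemma 20
`hW20`), the per-row data, and the STEP-0 identity `hstep0`. KL3-B, KL3-G and KL3-M are no longer inputs.
O5 OPEN; nothing booked; census = EVIDENCE.

## TYPER PLACEMENT NOTE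

Place AFTER part 7 (`O5/HeegnerLogTransportThreeResidual.lean`, ask A-O5-G20-1), part 8
(`O5/HeegnerLogTransportThreeBaseSelmer.lean`) and part 10 (`O5/HeegnerLogTransportThreeGoodSelmer.lean`, ask
A-O5-G21-1), which this file imports (it does NOT import part 7's END `O5/HeegnerLogTransportThreeResidualEnd.lean`);
THEOREMS only, namespace `Summit.BirchSwinnertonDyer.Rank1Residual.O5.HeegnerLogTransport`; no `def` here.
Checked by o5-r2 against the GEN 20 draft of part 7 and the GEN 21 parts 8/10 (concatenated scratch
`gen21/lean/scratch/scratch_p78910.lean`, `lean check` rc 0, 0 sorries, 0 warnings).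

## TYPER PLACEMENT NOTE (cc-typer-5 GEN 18 = O5 §3.5 / O6 §3.4 typer of record; by-name ask A-O5-G21-1 of o5-r2 GEN 21, HOME/INBOX.md l.13972:
'AFTER part 7, place by sha … parts 8, 10a, 10b, 9 — every file ≤ 353 l.')

Source: `HOME/b2b-bsdres-o5-r2/gen21/lean/HeegnerLogTransportThreeResidualEndFacts.lean` sha16 `c06b2a9d79c187af` (335 l.; `gen21/SHA16.txt`; o5-r2's `lean check` rc 0 / 0 warnings and joint scratch
`gen21/lean/scratch/scratch_p7_8_10ab_9.lean` b9f2316600933a64 rc 0, axioms of `o5_index_unit_of_ordinary_companion_facts` std), re-hashed by the typer right before writing;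
THIS file = KL3 part 9 = the source VERBATIM + this paragraph (imports, module text, every declaration block byte-identical; script `class-closure/typer-5/gen18/g21_place.py`);
the typer's own joint farm check of parts 7 (R2) + 8 + 10a + 10b + 9 over the tree: rc 0 / 0 warnings, axioms std; DEDUP `lean search --decl` on the new names: no match.
CONTENT LABELS (sources, unchanged): THEOREMS ONLY — 0 `def`, 0 `@[conjecture]`, 0 Literature facts (net named-fact debt 0), no `sorry`; published inputs stay displayed
hypotheses by NAME (`poitouTate_selmerStructure_duality`, `localEulerPoincareCharacteristic`, `gross_zagier`, `kolyvagin`, Yan–Zhu A10, Wuthrich L20, modularity) and the ONE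
typed node on the END's path is KL3-A `KrizLiUnitBitTransportThree` (part 1, p340741); KL3-B / KL3-G are NOT re-worded (their consumed directions are PROVED here / in part 10b).
KL3 parts in the tree: 1–3 p340741 / p341262 / p341640, Global p342632, OrdCompanion p343587 + p344465, OrdSelmer p345030 + p345686, OrdTwist p346273, Residual Engine p347366 +
Residual p348865 (+ End), Literature index lemma p344022.  HONEST FRAMING (cell `b2b-bsdres`): research route, lane CLASS-CLOSURE §3.5 O5; nothing asserted beyond the displayed
binders, nothing booked, no mark of `RESIDUAL-MAP.md` moves; census = EVIDENCE, never a Literature fact; O5 OPEN.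
-/

set_option autoImplicit false

noncomputable section

open scoped Classical

open WeierstrassCurve Literature.NumberTheory.EllipticCurves
  Literature.NumberTheory.EllipticCurves.ModularForms
  Literature.NumberTheory.EllipticCurves.Rank1Residual
  Literature.NumberTheory.EllipticCurves.Rank1Residual.Typed

namespace Summit.BirchSwinnertonDyer.Rank1Residual.O5.HeegnerLogTransport

open Summit.BirchSwinnertonDyer.Rank1Residual.X11b (padicLogOrd embAt padicPointOf index_zmultiples_zsmul)
open Summit.BirchSwinnertonDyer.Rank1Residual.X11b.LocalIndex (psi
  exists_addEquiv_valuation_psi_padicPointOf valuation_psi_zsmul_add)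
open Literature.NumberTheory.EllipticCurves.Rank1Residual (Addv)
open Summit.BirchSwinnertonDyer.Rank1Residual.Additive.LocalLog (reductionPointCount_of_addv)
open Summit.BirchSwinnertonDyer.Rank1Residual.X11b.AcSelmer (selmerAcBase)
open IsDedekindDomain (HeightOneSpectrum)
open Literature.NumberTheory.GaloisCohomology (poitouTate_sum_localTatePairing_eq_zero
  poitouTate_selmerStructure_duality poitouTate_sum_localTatePairing_eq_zero_of_selmerStructure_duality)
open Literature.NumberTheory.GaloisRepresentations (localEulerPoincareCharacteristic)
open scoped NumberField

/-! ## §1 The good-companion assembly without `hM` (GEN 20) and without `hB`, `hG` (GEN 21) -/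

/-- **KL3-C♭ (read at `ι₃ = embAt 𝔭`) on a companion GOOD at `3` whose Heegner pair satisfies BSD₃ — modulo
KL3-A and the two textbook facts only.** Verbatim GEN 20's `o5_index_unit_of_good_companion_selmer_residual`
(part 7 END) with the binders `hB : O5BaseSelmerCountThree` (KL3-B) and `hG : GoodBaseSelmerCountThree` (KL3-G)
DELETED: the use `selmerAcBase_card_eq_one_of_units hB …` is now the THEOREM `selmerAcBase_card_eq_one_of_facts …`
of part 8 and the use `sha_trivial_and_klLog_eq_of_selmer_trivial hG …` the THEOREM
`sha_trivial_and_klLog_eq_of_selmer_trivial_of_facts hPT hEP …` of part 10 (Poitou–Tate duality for Selmer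
structures `hPT`, local Euler characteristic `hEP`, and the END's own `htam`, `hKoW`/`hKoG`, Heegner data,
`hshaW`, `hQW`); the class binders `hj`, `hf₂` (consumed only by KL3-B) are dropped. All other binders and the
proof are unchanged. [cite: MilneADT2006, Ch. I, Thm. 4.10(b) and Thm. 2.8] [cite: KrizLi2019, Thm. 1.16, Rem. 1.17]
[cite: JetchevSkinnerWan2017, Prop. 3.2.1 and (7.1.5)] [cite: GreenbergLNM1716, §3 Lemma 3.3 (p. 87) and §5 p. 114] -/
theorem o5_index_unit_of_good_companion_selmer_facts
    (hA : KrizLiUnitBitTransportThree)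
    (hPT : ∀ (K : Type) [Field K] [NumberField K], poitouTate_selmerStructure_duality K)
    (hEP : ∀ (K : Type) [Field K] [NumberField K] (v : HeightOneSpectrum (𝓞 K)),
      localEulerPoincareCharacteristic (v.adicCompletion K))
    (W G : WeierstrassCurve ℚ) [W.IsElliptic] [W.IsGloballyMinimal] [G.IsElliptic] [G.IsGloballyMinimal]
    (hcong : ∀ ℓ : ℕ, ℓ.Prime → ¬ (ℓ ∣ 3 * W.conductorNorm ℤ * G.conductorNorm ℤ) →
      ((W.LFunction ℓ : ℤ) : ZMod 3) = ((G.LFunction ℓ : ℤ) : ZMod 3))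
    (hρ : W.HasSurjectiveModNGaloisRep 3) (hadd : Addv W 3) (hWa3 : W.LFunction 3 = 0)
    (ht3 : NoLocalThreeTorsionAt W 3)
    (htℓ : ∀ (ℓ : ℕ) [Fact ℓ.Prime], ℓ ≠ 3 → (ℓ : ℤ) ∣ W.conductorNorm ℤ * G.conductorNorm ℤ →
      NoLocalThreeTorsionAt W ℓ)
    (hNW : W.conductorNorm ℤ ≠ 0) (hNG : G.conductorNorm ℤ ≠ 0)
    (hunitW : ∀ ℓ ∈ klSet W G, ℓ ≠ 3 → padicValInt 3 (nsCount W ℓ) = 0)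
    (hunitG : ∀ ℓ ∈ klSet G W, ℓ ≠ 3 → padicValInt 3 (nsCount G ℓ) = 0)
    (htam : ¬ 3 ∣ W.tamagawaProduct) (htamG : ¬ 3 ∣ G.tamagawaProduct)
    (hgoodG : G.HasGoodReductionAtPrime 3)
    (Gd : WeierstrassCurve ℚ) [Gd.IsElliptic] (hfinG : Finite G.sha) (hfinGd : Finite Gd.sha)
    (hMG : MissingPPartAt G 3) (hMGd : MissingPPartAt Gd 3)
    {N N' : ℕ} [NeZero N] [NeZero N'] (D : ModularParametrizationData W N)
    (D' : ModularParametrizationData G N')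
    (K : Type) [Field K] [NumberField K] (hK : IsImaginaryQuadratic K)
    (hH : SatisfiesHeegnerHypothesis N K) (hH' : SatisfiesHeegnerHypothesis N' K)
    (hHWG : SatisfiesHeegnerHypothesis (W.conductorNorm ℤ * G.conductorNorm ℤ) K)
    (hKoW : kolyvagin N W K) (hKoG : kolyvagin N' G K)
    (hd : NumberField.discr K < -4) (h3d : ¬ ((3 : ℤ) ∣ NumberField.discr K))
    (hGd : ∃ C : VariableChange ℚ, C • G.quadraticTwist (NumberField.discr K : ℚ) = Gd)
    (H : HeegnerDatum N (NumberField.discr K)) (H' : HeegnerDatum N' (NumberField.discr K))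
    (ι : K →+* ℂ) (𝔭 : HeightOneSpectrum (𝓞 K)) (h𝔭 : ((3 : ℕ) : 𝓞 K) ∈ 𝔭.asIdeal)
    (he : 𝔭.asIdeal.ramificationIdx (𝓞 ℚ) = 1) (hf : 𝔭.asIdeal.inertiaDeg (𝓞 ℚ) = 1)
    (P : (W.baseChange K).toAffine.Point) (P' : (G.baseChange K).toAffine.Point)
    (hP : WeierstrassCurve.Affine.Point.map ι.toRatAlgHom P = heegnerPointComplex D H)
    (hP' : WeierstrassCurve.Affine.Point.map ι.toRatAlgHom P' = heegnerPointComplex D' H')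
    (hPinf : ¬ IsOfFinAddOrder P) (hP'inf : ¬ IsOfFinAddOrder P')
    (hshaW : Nat.card (AddCommGroup.primaryComponent (W.baseChange K).sha 3) = 1)
    (hQW : ∃ Q : (W.baseChange K).toAffine.Point, ¬ IsOfFinAddOrder Q ∧
      padicLogOrd W 3 (embAt K 3 𝔭 h𝔭 he hf) Q = 0)
    (hcD : padicValInt 3 D.maninConstant = 0) (hcD' : padicValInt 3 D'.maninConstant = 0)
    {q₀ q₁ : ℚ} (hq₀ : shaAn G = (q₀ : ℂ)) (hq₁ : shaAn Gd = (q₁ : ℂ))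
    (hstep0 : padicValRat 3 q₀ + padicValRat 3 q₁ + ((2 * padicValNat 3 G.tamagawaProduct : ℕ) : ℤ) +
        ((2 * padicValInt 3 D'.maninConstant : ℕ) : ℤ) =
      ((2 * padicValNat 3 (AddSubgroup.zmultiples P').index : ℕ) : ℤ)) :
    padicValNat 3 (AddSubgroup.zmultiples P).index = 0 := by
  haveI : Finite G.sha := hfinG
  haveI : Finite Gd.sha := hfinGd
  -- W side: `W(K)[3] = 0`, `3 ∤ c₃(W)`, finite index, and L1′
  have htorsW := nsmul_eq_zero_imp_eq_zero_of_surj W K hK (by norm_num) hρ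
  have hc3 := not_dvd_localTamagawaNumber_of_not_dvd_tamagawaProduct W htam
  have hI0W : (AddSubgroup.zmultiples P).index ≠ 0 :=
    index_zmultiples_ne_zero_of_isHeegnerPoint N W K hKoW hK hH ⟨D, H, ι, hP⟩ hPinf
  obtain ⟨Q, hQinf, hQunit⟩ := hQW
  have hlog := padicLogOrd_eq_padicValNat_index_of_logUnit W hadd hc3 htorsW (embAt K 3 𝔭 h𝔭 he hf) P Q
    hPinf hQinf hI0W hQunit
  -- KL3-B♭ (THEOREM, part 8): `Sel_𝔭(K, W[3^∞]) = 0`; KL3-M° (THEOREM, part 7): `Sel_𝔭(K, G[3^∞]) = 0`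
  have hSelW := selmerAcBase_card_eq_one_of_facts
    (fun K _ _ => poitouTate_sum_localTatePairing_eq_zero_of_selmerStructure_duality (hPT K)) hEP W hadd
    htam ht3 D K hK hH hKoW H ι P hP hPinf
    𝔭 h𝔭 he hf hshaW ⟨Q, hQinf, hQunit⟩
  have hSelG : Nat.card (selmerAcBase (G.baseChange K) 3 𝔭 ∅) = 1 :=
    (natCard_selmerAcBase_eq_one_iff_companion W G hρ hcong ht3 htℓ K hK hHWG 𝔭 h𝔭 he hf).mp hSelW
  -- companion-side hypotheses transported along `ρ̄_{G,3} ≅ ρ̄_{W,3}`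
  have hirrW : W.HasIrreducibleModPGaloisRep 3 :=
    hasIrreducibleModPGaloisRep_of_hasSurjectiveModNGaloisRep W 3 hρ
  have ht3G : NoLocalThreeTorsionAt G 3 := noLocalThreeTorsionAt_of_isCongruentModThree W G hirrW hcong 3 ht3
  have htorsG := nsmul_eq_zero_imp_eq_zero_of_isCongruentModThree W G hirrW hcong K htorsW
  haveI : (G.baseChange K).IsElliptic := by rw [WeierstrassCurve.baseChange]; infer_instance
  have hKol := hKoG hK hH' ⟨D', H', ι, hP'⟩ hP'inf
  have hI0G : (AddSubgroup.zmultiples P').index ≠ 0 :=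
    index_zmultiples_ne_zero_of_isHeegnerPoint N' G K hKoG hK hH' ⟨D', H', ι, hP'⟩ hP'inf
  -- KL3-G read backwards: `Ш(G/K)[3^∞] = 0` and the KL-normalised log of `P′` has the valuation of the index
  obtain ⟨hshaG, hklG⟩ := sha_trivial_and_klLog_eq_of_selmer_trivial_of_facts hPT hEP G hgoodG ht3G K hK
    htorsG hKol.1
    hKol.2 P' hP'inf hI0G 𝔭 h𝔭 he hf hSelG
  -- BSD₃ of the pair `(G, G^{(d_K)})`: `3 ∤ [G(K) : ℤP′]`, so the companion Heegner log is a `3`-adic unit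
  obtain ⟨hu₀, hu₁⟩ := padicValRat_shaAn_pair_eq_zero_of_sha_trivial G Gd K hK hGd 3 (by decide) hMG hMGd
    hq₀ hq₁ hshaG
  obtain ⟨hI, -⟩ := padicValNat_index_eq_zero_of_missingPPartAt_pair G Gd K hK hGd 3 (by decide) hMG hMGd
    P' hq₀ hq₁ hstep0 hu₀ hu₁ (padicValNat.eq_zero_of_not_dvd htamG) hcD'
  have hGunit : padicLogOrd G 3 (embAt K 3 𝔭 h𝔭 he hf) P' + padicValInt 3 (nsCount G 3) - 1 = 0 := by
    rw [hklG, hI, Nat.cast_zero]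
  -- KL3-A: the W-side chain of GEN 16
  exact padicValNat_index_eq_zero_of_companion_unit' hA W G hcong hρ hadd hWa3 hNW hNG hunitW hunitG htam
    D D' K hK hH hH' hd h3d H H' ι (embAt K 3 𝔭 h𝔭 he hf) P P' hP hP' hPinf hP'inf hcD hcD' hGunit

/-- **Row C16 plugged in, modulo KL3-A and the two textbook facts only**: verbatim GEN 20's
`o5_index_unit_of_goodOrd_companion_selmer_residual` with the binders `hB` (KL3-B), `hG` (KL3-G) replaced by
`hPT`, `hEP` (part 8 proves the consumed direction of KL3-B at the additive prime, part 10 proves KL3-G) and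
`hj`, `hf₂` dropped.
[cite: MilneADT2006, Ch. I, Thm. 4.10(b) and Thm. 2.8] [cite: YanZhu2024MainConjNonCM, Thm. 4.15 (§4.6)] [cite: KrizLi2019, Thm. 1.16]
[cite: GreenbergLNM1716, §3 Lemma 3.3 (p. 87) and §5 p. 114] -/
theorem o5_index_unit_of_goodOrd_companion_selmer_facts
    (hA : KrizLiUnitBitTransportThree)
    (hPT : ∀ (K : Type) [Field K] [NumberField K], poitouTate_selmerStructure_duality K)
    (hEP : ∀ (K : Type) [Field K] [NumberField K] (v : HeightOneSpectrum (𝓞 K)),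
      localEulerPoincareCharacteristic (v.adicCompletion K))
    (hYZ : YanZhu2026.thm415_padicValRat_bsd_rank_le_one)
    (hW20 : Wuthrich2014.lemma20_surjective_threeAdic_of_semistable)
    (hmod : hasEntireLFunction_rat) (hGZK : rank_eq_analyticRank_of_analyticRank_le_one)
    (W G : WeierstrassCurve ℚ) [W.IsElliptic] [W.IsGloballyMinimal] [G.IsElliptic] [G.IsGloballyMinimal]
    (hcong : ∀ ℓ : ℕ, ℓ.Prime → ¬ (ℓ ∣ 3 * W.conductorNorm ℤ * G.conductorNorm ℤ) →
      ((W.LFunction ℓ : ℤ) : ZMod 3) = ((G.LFunction ℓ : ℤ) : ZMod 3))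
    (hρ : W.HasSurjectiveModNGaloisRep 3) (hadd : Addv W 3) (hWa3 : W.LFunction 3 = 0)
    (ht3 : NoLocalThreeTorsionAt W 3)
    (htℓ : ∀ (ℓ : ℕ) [Fact ℓ.Prime], ℓ ≠ 3 → (ℓ : ℤ) ∣ W.conductorNorm ℤ * G.conductorNorm ℤ →
      NoLocalThreeTorsionAt W ℓ)
    (hNW : W.conductorNorm ℤ ≠ 0) (hNG : G.conductorNorm ℤ ≠ 0)
    (hunitW : ∀ ℓ ∈ klSet W G, ℓ ≠ 3 → padicValInt 3 (nsCount W ℓ) = 0)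
    (hunitG : ∀ ℓ ∈ klSet G W, ℓ ≠ 3 → padicValInt 3 (nsCount G ℓ) = 0)
    (htam : ¬ 3 ∣ W.tamagawaProduct) (htamG : ¬ 3 ∣ G.tamagawaProduct)
    (hrG : G.analyticRank ≤ 1) (hC16 : RowC16 G 3)
    (Gd : WeierstrassCurve ℚ) [Gd.IsElliptic] [Gd.IsGloballyMinimal] (hrGd : Gd.analyticRank ≤ 1)
    (hC16d : RowC16 Gd 3)
    {N N' : ℕ} [NeZero N] [NeZero N'] (D : ModularParametrizationData W N)
    (D' : ModularParametrizationData G N')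
    (K : Type) [Field K] [NumberField K] (hK : IsImaginaryQuadratic K)
    (hH : SatisfiesHeegnerHypothesis N K) (hH' : SatisfiesHeegnerHypothesis N' K)
    (hHWG : SatisfiesHeegnerHypothesis (W.conductorNorm ℤ * G.conductorNorm ℤ) K)
    (hKoW : kolyvagin N W K) (hKoG : kolyvagin N' G K)
    (hd : NumberField.discr K < -4) (h3d : ¬ ((3 : ℤ) ∣ NumberField.discr K))
    (hGd : ∃ C : VariableChange ℚ, C • G.quadraticTwist (NumberField.discr K : ℚ) = Gd)
    (H : HeegnerDatum N (NumberField.discr K)) (H' : HeegnerDatum N' (NumberField.discr K))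
    (ι : K →+* ℂ) (𝔭 : HeightOneSpectrum (𝓞 K)) (h𝔭 : ((3 : ℕ) : 𝓞 K) ∈ 𝔭.asIdeal)
    (he : 𝔭.asIdeal.ramificationIdx (𝓞 ℚ) = 1) (hf : 𝔭.asIdeal.inertiaDeg (𝓞 ℚ) = 1)
    (P : (W.baseChange K).toAffine.Point) (P' : (G.baseChange K).toAffine.Point)
    (hP : WeierstrassCurve.Affine.Point.map ι.toRatAlgHom P = heegnerPointComplex D H)
    (hP' : WeierstrassCurve.Affine.Point.map ι.toRatAlgHom P' = heegnerPointComplex D' H')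
    (hPinf : ¬ IsOfFinAddOrder P) (hP'inf : ¬ IsOfFinAddOrder P')
    (hshaW : Nat.card (AddCommGroup.primaryComponent (W.baseChange K).sha 3) = 1)
    (hQW : ∃ Q : (W.baseChange K).toAffine.Point, ¬ IsOfFinAddOrder Q ∧
      padicLogOrd W 3 (embAt K 3 𝔭 h𝔭 he hf) Q = 0)
    (hcD : padicValInt 3 D.maninConstant = 0) (hcD' : padicValInt 3 D'.maninConstant = 0)
    {q₀ q₁ : ℚ} (hq₀ : shaAn G = (q₀ : ℂ)) (hq₁ : shaAn Gd = (q₁ : ℂ))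
    (hstep0 : padicValRat 3 q₀ + padicValRat 3 q₁ + ((2 * padicValNat 3 G.tamagawaProduct : ℕ) : ℤ) +
        ((2 * padicValInt 3 D'.maninConstant : ℕ) : ℤ) =
      ((2 * padicValNat 3 (AddSubgroup.zmultiples P').index : ℕ) : ℤ)) :
    padicValNat 3 (AddSubgroup.zmultiples P).index = 0 := by
  haveI : Finite G.sha := (hGZK G hrG).2
  haveI : Finite Gd.sha := (hGZK Gd hrGd).2
  have hMG : MissingPPartAt G 3 := missingPPartAt_of_bsdp G 3 (RowC16.bsdp hYZ hW20 hmod hGZK hrG hC16)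
  have hMGd : MissingPPartAt Gd 3 :=
    missingPPartAt_of_bsdp Gd 3 (RowC16.bsdp hYZ hW20 hmod hGZK hrGd hC16d)
  exact o5_index_unit_of_good_companion_selmer_facts hA hPT hEP W G hcong hρ hadd hWa3 ht3 htℓ hNW hNG
    hunitW hunitG htam htamG hC16.2.1.1 Gd ‹Finite G.sha› ‹Finite Gd.sha› hMG hMGd D D' K hK hH hH' hHWG
    hKoW hKoG hd h3d hGd H H' ι 𝔭 h𝔭 he hf P P' hP hP' hPinf hP'inf hshaW hQW hcD hcD' hq₀ hq₁ hstep0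

/-! ## §2 GEN 19's END without `hM`, `hB`, `hG` — the END of GEN 21 -/

/-- **END of o5-r2 GEN 21 — KL3-C♭ (read at `ι₃ = embAt 𝔭`) on a good-ORDINARY companion, modulo KL3-A and
two textbook facts; row-C16 decoration discharged (GEN 19), KL3-M discharged (GEN 20), KL3-B and KL3-G
discharged (GEN 21).** Verbatim GEN 20's `o5_index_unit_of_ordinary_companion_residual` (part 7 END) with the
binders `hB : O5BaseSelmerCountThree`, `hG : GoodBaseSelmerCountThree` replaced by `hPT`, `hEP` and `hj`, `hf₂`
dropped. The remaining typed / named inputs: `hA` KL3-A (Kriz–Li unit-bit transport, print — the ONE typed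
node left), `hPT` (Poitou–Tate duality for Selmer structures, Milne ADT I 4.10 / Howard 2.1.11), `hEP` (local
Euler characteristic, Milne ADT I 2.8), `hYZ` (Yan–Zhu 2026 Thm. 4.15), `hW20`
(Wuthrich Lemma 20), `hmod` (modularity), `hGZK`/`hGZG` (Gross–Zagier–Kolyvagin), `hKoW`/`hKoG` (Kolyvagin),
the per-row data, and the STEP-0 identity `hstep0`. [cite: MilneADT2006, Ch. I, Thm. 4.10(b) and Thm. 2.8] [cite: YanZhu2024MainConjNonCM, Thm. 4.15 (§4.6)] [cite: KrizLi2019, Thm. 1.16, Rem. 1.17]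
[cite: JetchevSkinnerWan2017, Prop. 3.2.1 and (7.1.5)] [cite: GrossZagier1986, Thm. I.6.3 with V.§2]
[cite: GreenbergLNM1716, §3 Lemma 3.3 (p. 87) and §5 p. 114] -/
theorem o5_index_unit_of_ordinary_companion_facts
    (hA : KrizLiUnitBitTransportThree)
    (hPT : ∀ (K : Type) [Field K] [NumberField K], poitouTate_selmerStructure_duality K)
    (hEP : ∀ (K : Type) [Field K] [NumberField K] (v : HeightOneSpectrum (𝓞 K)),
      localEulerPoincareCharacteristic (v.adicCompletion K))
    (hYZ : YanZhu2026.thm415_padicValRat_bsd_rank_le_one)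
    (hW20 : Wuthrich2014.lemma20_surjective_threeAdic_of_semistable)
    (hmod : exists_isNewformOf) (hGZK : rank_eq_analyticRank_of_analyticRank_le_one)
    (W G : WeierstrassCurve ℚ) [W.IsElliptic] [W.IsGloballyMinimal] [G.IsElliptic] [G.IsGloballyMinimal]
    (hcong : ∀ ℓ : ℕ, ℓ.Prime → ¬ (ℓ ∣ 3 * W.conductorNorm ℤ * G.conductorNorm ℤ) →
      ((W.LFunction ℓ : ℤ) : ZMod 3) = ((G.LFunction ℓ : ℤ) : ZMod 3))
    (hρ : W.HasSurjectiveModNGaloisRep 3) (hadd : Addv W 3) (ht3 : NoLocalThreeTorsionAt W 3)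
    (htℓ : ∀ (ℓ : ℕ) [Fact ℓ.Prime], ℓ ≠ 3 → (ℓ : ℤ) ∣ W.conductorNorm ℤ * G.conductorNorm ℤ →
      NoLocalThreeTorsionAt W ℓ)
    (hunitW : ∀ ℓ ∈ klSet W G, ℓ ≠ 3 → padicValInt 3 (nsCount W ℓ) = 0)
    (hunitG : ∀ ℓ ∈ klSet G W, ℓ ≠ 3 → padicValInt 3 (nsCount G ℓ) = 0)
    (htam : ¬ 3 ∣ W.tamagawaProduct) (htamG : ¬ 3 ∣ G.tamagawaProduct) (hordG : GoodOrd G 3)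
    (Gd : WeierstrassCurve ℚ) [Gd.IsElliptic] [Gd.IsGloballyMinimal]
    {N N' : ℕ} [NeZero N] [NeZero N'] (D : ModularParametrizationData W N)
    (D' : ModularParametrizationData G N')
    (K : Type) [Field K] [NumberField K] (hK : IsImaginaryQuadratic K)
    (hH : SatisfiesHeegnerHypothesis N K) (hH' : SatisfiesHeegnerHypothesis N' K)
    (hKoW : kolyvagin N W K) (hKoG : kolyvagin N' G K) (hGZG : gross_zagier N' G K)
    (hd : NumberField.discr K < -4) (h3d : ¬ ((3 : ℤ) ∣ NumberField.discr K))
    (hGd : ∃ C : VariableChange ℚ, C • G.quadraticTwist (NumberField.discr K : ℚ) = Gd)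
    (H : HeegnerDatum N (NumberField.discr K)) (H' : HeegnerDatum N' (NumberField.discr K))
    (ι : K →+* ℂ) (𝔭 : HeightOneSpectrum (𝓞 K)) (h𝔭 : ((3 : ℕ) : 𝓞 K) ∈ 𝔭.asIdeal)
    (he : 𝔭.asIdeal.ramificationIdx (𝓞 ℚ) = 1) (hf : 𝔭.asIdeal.inertiaDeg (𝓞 ℚ) = 1)
    (P : (W.baseChange K).toAffine.Point) (P' : (G.baseChange K).toAffine.Point)
    (hP : WeierstrassCurve.Affine.Point.map ι.toRatAlgHom P = heegnerPointComplex D H)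
    (hP' : WeierstrassCurve.Affine.Point.map ι.toRatAlgHom P' = heegnerPointComplex D' H')
    (hPinf : ¬ IsOfFinAddOrder P) (hP'inf : ¬ IsOfFinAddOrder P')
    (hshaW : Nat.card (AddCommGroup.primaryComponent (W.baseChange K).sha 3) = 1)
    (hQW : ∃ Q : (W.baseChange K).toAffine.Point, ¬ IsOfFinAddOrder Q ∧
      padicLogOrd W 3 (embAt K 3 𝔭 h𝔭 he hf) Q = 0)
    (hcD : padicValInt 3 D.maninConstant = 0) (hcD' : padicValInt 3 D'.maninConstant = 0)
    {q₀ q₁ : ℚ} (hq₀ : shaAn G = (q₀ : ℂ)) (hq₁ : shaAn Gd = (q₁ : ℂ))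
    (hstep0 : padicValRat 3 q₀ + padicValRat 3 q₁ + ((2 * padicValNat 3 G.tamagawaProduct : ℕ) : ℤ) +
        ((2 * padicValInt 3 D'.maninConstant : ℕ) : ℤ) =
      ((2 * padicValNat 3 (AddSubgroup.zmultiples P').index : ℕ) : ℤ)) :
    padicValNat 3 (AddSubgroup.zmultiples P).index = 0 := by
  -- the class-level discharges of GEN 19
  have hE : hasEntireLFunction_rat := hasEntireLFunction_rat_of_exists_isNewformOf hmod
  have hWa3 : W.LFunction 3 = 0 :=
    W.LFunction_apply_eq_zero_of_not_good_of_not_mult 3 hadd.1 hadd.2 (dvd_refl 3)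
  have hNW : W.conductorNorm ℤ ≠ 0 := (W.conductorNorm_pos_holds).ne'
  have hNG : G.conductorNorm ℤ ≠ 0 := (G.conductorNorm_pos_holds).ne'
  have hN' : N' = G.conductorNorm ℤ :=
    IsNewformOf.level_eq_conductorNorm_of_exists_isNewformOf hmod D'.isNewformOf
  have hHG : SatisfiesHeegnerHypothesis (G.conductorNorm ℤ) K := hN' ▸ hH'
  have hHWG : SatisfiesHeegnerHypothesis (W.conductorNorm ℤ * G.conductorNorm ℤ) K :=
    satisfiesHeegnerHypothesis_conductor_mul_of_level hmod W G D D' K hH hH'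
  -- row C16 for `G` (§1) and for `Gd` (§2)
  have hC16 : RowC16 G 3 := rowC16_three_of_goodOrd_of_isCongruentModThree W G hcong hρ hordG
  have hC16d : RowC16 Gd 3 := rowC16_three_twist_of_heegner G Gd K hK hHG h3d hGd hC16
  -- the analytic ranks of the pair (§3)
  obtain ⟨hrG, hrGd⟩ := analyticRank_pair_le_one_of_heegner_nonTorsion hmod G D' K hK hH' hGZG Gd hGd
    ⟨D', H', ι, hP'⟩ hP'inf
  exact o5_index_unit_of_goodOrd_companion_selmer_facts hA hPT hEP hYZ hW20 hE hGZK W G hcong hρ hadd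
    hWa3 ht3 htℓ hNW hNG hunitW hunitG htam htamG hrG hC16 Gd hrGd hC16d D D' K hK hH hH' hHWG hKoW hKoG
    hd h3d hGd H H' ι 𝔭 h𝔭 he hf P P' hP hP' hPinf hP'inf hshaW hQW hcD hcD' hq₀ hq₁ hstep0

end Summit.BirchSwinnertonDyer.Rank1Residual.O5.HeegnerLogTransport

end
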